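import Summits.BirchSwinnertonDyer.BirchSwinnertonDyer.Theorems.EisensteinPrimesBSDpOnCellCOfCitedFactsV20
import Summits.BirchSwinnertonDyer.BirchSwinnertonDyer.Theorems.EisensteinPrimesBSDpOnCellCTelescopeK2ModuleDivOfLeavesFPGM
import HarnessLib

/-!
# [telescope v20 — width seat bsd-line-x2-p2 g26, 2026-08-30] CRUX 4 `BSDpOnCellC` FROM THE CITED FACTS WITH THREE (NOT FOUR) KELLER–YIN CONJUNCTS, T-An-2ʳ AND CRUX 3 —
# CONDITIONAL CLOSURE, SORRY-FREE (sibling of p782040 `…OfCitedFactsV20.bsdpOnCellC_of_citedFactsR` with ONE hypothesis conjunct FEWER; `--supports`, helper; CONDITIONAL — closes nothing)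
# Crux 4 `BSDpOnCellC` (stmt-BirchSwinnertonDyer-19034), line «telescope» v20.

WHAT: `bsdpOnCellC_of_citedFactsR_pre3 (hPub) (hPre) (hRat) (hMazur) : …Theses.EisensteinPrimes.BSDpOnCellC` with `hPub` = v20's `stub_publishedFacts` text (23 refereed named facts)
token for token, `hRat` = T-An-2ʳ, `hMazur` = crux 3 VERBATIM, and **`hPre` = the FIRST THREE conjuncts of v20's `stub_preprintFacts` only** (Keller–Yin 2024 Thm. 3.0.8 (IMC2′) dvd,
Thm. 2.2.2 (anacong) μ, λ = the `hPre` of `…OfNamedFactsV22.bsdpOnCellC_of_namedFactsV22P` token for token): the FOURTH conjunct `KellerYin2024.thm308_imc2_hidaMember_isTorsion_OPEN`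
(KY24 Thm. 3.0.8 TORSION clause; typed by LEAD g2 p747458, registered since telescope v9) is NOT a hypothesis. PROOF = the v20 composition line (`Cruxes/BSDpOnCellC/Lines/telescope.lean`
l.518–540) with the three-leaf glue `TelescopeK2ModuleDivOfLeavesFPG.branchFibreDiv_of_leaves N1 N2 (TelescopeK2MemberControlOfModF.memberControl_of_mod N3″ pre.2.2.2)` replaced by
`TelescopeK2ModuleDivOfLeavesFPGM.branchFibreDiv_of_leaves_of_modCofinite N1 N2 N3″` ((reg_k) off a finite set from N2's (reg₀) — `TelescopeK2MemberRegOffFinite`); every other token unchanged.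
MEANING: the by-name register of crux 4 is 23 refereed + KY24 ×3 + T-An-2ʳ + crux 3 = 27 + crux 3 (v20 books 28 + crux 3). A v21 reshape (`stub_preprintFacts` 4 → 3 conjuncts, glue swap), if any, is the LEAD's
registry act under a director word; this file is the kernel evidence for it.
HONEST FRAMING: CONDITIONAL result (the gate records it as such); it discharges none of its hypotheses; closes no registered stub, no crux, no summit statement; BSD is proved for no
curve by this file. THEOREMS ONLY: no definition, no named fact, no instance, no `sorry`.
References (shape only): [cite: KellerYin2024, Thm. 3.0.8, Thm. 2.2.2 (arXiv:2402.12781v2)] [cite: GreenbergVatsal2000, Thm. (1.3)] [cite: Wiles1988, §2.2] [cite: Hida1986, Cor. 1.3, Cor. 1.4]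
-/

set_option autoImplicit false
set_option linter.dupNamespace false

noncomputable section

open scoped Classical MatrixGroups ModularForm

open CongruenceSubgroup WeierstrassCurve NumberField IsDedekindDomain Field PowerSeries
  Literature.NumberTheory.EllipticCurves Literature.NumberTheory.EllipticCurves.GreenbergSelmer
  Literature.NumberTheory.EllipticCurves.ModularForms Literature.NumberTheory.QuadraticFields
  Literature.NumberTheory.EllipticCurves.Rank1Residual
  Literature.NumberTheory.EllipticCurves.Rank1Residual.Typed
  Literature.NumberTheory.EllipticCurves.KrizLi2019
  Literature.NumberTheory.EllipticCurves.GreenbergVatsal2000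
  Literature.NumberTheory.EllipticCurves.Wuthrich2014
  Literature.NumberTheory.EllipticCurves.SteinWuthrich2013
  Literature.NumberTheory.EllipticCurves.Castella2018Exceptional
  Literature.NumberTheory.GaloisRepresentations Literature.NumberTheory.GaloisCohomology
  Literature.NumberTheory.Automorphic
  Summit.BirchSwinnertonDyer.Rank1Residual.X11b.AcSelmer
  Summit.BirchSwinnertonDyer.Rank1Residual.X11b.Halves
  Summit.BirchSwinnertonDyer.Rank1Residual.X11b
  Summit.BirchSwinnertonDyer.Rank1Residual Summit.BirchSwinnertonDyer.Rank1Residual.X1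
  Summit.BirchSwinnertonDyer.Rank1Residual.X2
open Literature.NumberTheory.EllipticCurves.KellerYin2024 (curveLocalLambda)


open Literature.NumberTheory.EllipticCurves.BigGaloisRep

namespace Summit.BirchSwinnertonDyer.BirchSwinnertonDyer.Theorems.EisensteinPrimesBSDpOnCellCOfCitedFactsR3

open Literature.NumberTheory.EllipticCurves.CastellaGrossiLeeSkinner2022 Literature.NumberTheory.EllipticCurves.Castella2018
  Literature.NumberTheory.IwasawaTheory Literature.NumberTheory.IwasawaTheory.Greenberg2016
  Literature.NumberTheory.IwasawaTheory.Greenberg2006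
  Summit.BirchSwinnertonDyer.Rank1Residual.X1.KellerYinMuLambdaSplit
open Literature.NumberTheory.EllipticCurves.KellerYin2024
open Summit.BirchSwinnertonDyer.BirchSwinnertonDyer.Theorems

/-- **Crux 4 `BSDpOnCellC` from the 23 refereed facts, Keller–Yin ×3 (NO torsion clause), T-An-2ʳ and crux 3 (telescope v20 chain with the FPGM glue; conditional closure).**
Proof = the v20 composition with `branchFibreDiv_of_leaves_of_modCofinite N1 N2 N3″` in the three-leaf slot. CONDITIONAL: nothing here discharges the hypotheses.
[cite: KellerYin2024, Thm. 3.0.8 (shape only)] [cite: GreenbergVatsal2000, Thm. (1.3) (shape only)] -/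
theorem bsdpOnCellC_of_citedFactsR_pre3
    (hPub :
    ((((lambdaMu_multiplicative_of_gvPar ∧ thm16_charIdeal_dvd_multiplicative_of_reducible ∧
    thm61_splitMultiplicative ∧ thm61_nonsplitMultiplicative ∧
    (∀ (W : WeierstrassCurve ℚ) [W.IsElliptic] [W.IsGloballyMinimal] (p : ℕ) [Fact p.Prime],
      greenberg_stevens (W := W) (p := p)) ∧
    exists_isNewformOf ∧
    hsieh2014_exists_anticyclotomicPAdicLFunction ∧
    (∀ (N : ℕ) [NeZero N] (W : WeierstrassCurve ℚ) (K : Type) [Field K] [NumberField K],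
      gross_zagier N W K) ∧
    (∀ (N : ℕ) [NeZero N] (W : WeierstrassCurve ℚ) (K : Type) [Field K] [NumberField K],
      kolyvagin N W K) ∧
    rank_eq_analyticRank_of_analyticRank_le_one ∧ HoffsteinLuo1997_exists_twist_L_one_ne_zero ∧
    mazur_not_dvd_maninConstant_of_odd ∧ bsdRHS_eq_of_isIsogenous) ∧
    thm210_thm211_bdpDisplay_pNew) ∧
    LiuZhangZhang2018.thm151_thm153_modularCurve_heegnerVector) ∧
    (prop125_characterGrSelmerDual_torsion_muZero_dim ∧
      cor126_residualCharacter_globalLift ∧ cor126_residualCharacter_localSurjective ∧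
      thm212_exists_isKatzLFunction ∧
      Literature.NumberTheory.EllipticCurves.Castella2018.cas20_thm211_memberForms_sigmaFrames_congr)) ∧
      Literature.NumberTheory.EllipticCurves.BCGKPST2020.thm331_rubin_exists_katzMeasure₂_pseudoIso_span_eq ∧
      Literature.NumberTheory.EllipticCurves.DeShalit1987.thmII64_katzMeasure₂_functionalEquation ∧
      Literature.NumberTheory.EllipticCurves.Hida2010MuInvariant.thmI_mu_katzBranch_reflect_eq_zero)
    (hPre :
    Literature.NumberTheory.EllipticCurves.KellerYin2024.thm308_imc2_hidaMember_dvd_OPEN ∧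
      Literature.NumberTheory.EllipticCurves.KellerYin2024.thm222_anacong_hidaMember_sigma_mu_OPEN ∧
      Literature.NumberTheory.EllipticCurves.KellerYin2024.thm222_anacong_hidaMember_sigma_lambda_OPEN)
    (hRat : Literature.NumberTheory.EllipticCurves.hida1986_castella2020_exists_rationalMembers_on_pNewBranchChart)
    (hMazur :
    Summit.BirchSwinnertonDyer.BirchSwinnertonDyer.Theses.EisensteinPrimes.MazurMCOnCellB) :
    Summit.BirchSwinnertonDyer.BirchSwinnertonDyer.Theses.EisensteinPrimes.BSDpOnCellC :=
  Summit.BirchSwinnertonDyer.BirchSwinnertonDyer.Theorems.EisensteinPrimesBSDpOnCellCOfNamedFactsV22.bsdpOnCellC_of_namedFactsV22P hPub hPre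
    (Summit.BirchSwinnertonDyer.BirchSwinnertonDyer.Theorems.TelescopeCarrierOfAnDistRatOfAlgFPG.carrier_of_anDistRat_of_algFP
      (Summit.BirchSwinnertonDyer.BirchSwinnertonDyer.Theorems.TelescopeCarrierAnDistRatGalOfGaloisLattice.carrierAnDistRatGal_of_galoisLattice
        (Summit.BirchSwinnertonDyer.BirchSwinnertonDyer.Theorems.TelescopeBranchGaloisLatticeOfUntwistedFact.galoisLattice_of_untwistedGaloisLattice
          (Summit.BirchSwinnertonDyer.BirchSwinnertonDyer.Theorems.TelescopeBranchUntwistedOfFrobenius.untwistedGaloisLattice_of_frobeniusGaloisLattice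
            (Summit.BirchSwinnertonDyer.BirchSwinnertonDyer.Theorems.TelescopeBranchFrobeniusLatticeOfChart.frobeniusGaloisLattice_of_rationalMembers
              hRat))))
      (Summit.BirchSwinnertonDyer.BirchSwinnertonDyer.Theorems.TelescopeCarrierAlgOfWitnessFPG.carrierAlg_of_witness
        (Summit.BirchSwinnertonDyer.BirchSwinnertonDyer.Theorems.TelescopeCarrierAlgWOfDivIntFPG.carrierAlgW_of_divInt
          (Summit.BirchSwinnertonDyer.BirchSwinnertonDyer.Theorems.TelescopeK2DivIntOfModuleDivFPG.carrierDivInt_of_branchFibreDiv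
            (Summit.BirchSwinnertonDyer.BirchSwinnertonDyer.Theorems.TelescopeK2ModuleDivOfLeavesFPGM.branchFibreDiv_of_leaves_of_modCofinite
              Summit.BirchSwinnertonDyer.BirchSwinnertonDyer.Theorems.TelescopeBranchLatticeOfPkgG.branchLattice_of_pkgG
              (Summit.BirchSwinnertonDyer.BirchSwinnertonDyer.Theorems.TelescopeK2WeightTwoControlOfPubOfPseudoNullT.weightTwoControlOfPub_of_pseudoNull
                Summit.BirchSwinnertonDyer.BirchSwinnertonDyer.Theorems.TelescopeWeightTwoPseudoNullOfPub.stub_weightTwoPseudoNullOfPub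
                hPub)
              Summit.BirchSwinnertonDyer.BirchSwinnertonDyer.Theorems.TelescopeMemberControlModCofinite.stub_memberControlModCofinite)))
        Summit.BirchSwinnertonDyer.BirchSwinnertonDyer.Theorems.TelescopeHerbrandTranslate.stub_herbrandTranslate))
    hMazur

end Summit.BirchSwinnertonDyer.BirchSwinnertonDyer.Theorems.EisensteinPrimesBSDpOnCellCOfCitedFactsR3

end
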